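import Summits.HodgeConjecture.HodgeConjecture.Theorems.MarkmanPartnerTransportPicardThreeK3SquaresQuadraticLemmas

/-!
# Route MarkmanPartnerTransport · crux `PicardThreeK3Squares` (stmt-HodgeConjecture-19652) —
# the quadratic relation `f² = a f + b` and cup-self-adjointness of a non-scalar transcendental Hodge
# endomorphism, at the ranks `22 − ρ(S) ∈ {6, 8, 10, 14}`

Part 1 of the existence of the real-quadratic generator (prover seat hodge-nonav-19652-p1, gen 9; consumer
`…PicardThreeK3SquaresQuadraticGenerator`): for a projective K3 surface `S`, not CM, with
«`d · m + ρ(S) = 22`, `d ≥ 2`, `m ≥ 3` forces `d = 2`», and `f ∈ End H²(S(ℂ); ℂ)` rational, type-preserving,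
killing `N¹(S)`, with image cup-orthogonal to `N¹(S)`, NOT a rational scalar on `T(S)`:

* `exists_quadratic_relation_selfAdjoint` — there are `a, b ∈ ℚ`, `b ≠ 0`, `a² + 4b ≠ 0`, with
  `f² = a f + b` on `T(S)`, `f` cup-self-adjoint on all of `H²(S(ℂ); ℂ)`, and on every non-zero
  `(2,0)`-class the eigenvalue `ev` of `f` satisfies `ev² = a ev + b` and is irrational.

Marking picture of `OneCycle.generatedBy_or_hasComplexMultiplication_of_eigenvalue` (gen 8): transcendental
Hodge structure `hodgeT` on `T = N_ℚ^⊥` (irreducible of K3 type, polarized), `E = End_Hdg(T)` a field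
(Zarhin) with the `(2,0)`-eigenvalue embedding `ε`; `f` read in `E` as `r`; `r ∉ ℚ` (else `f` scalar on
`T`); `E` totally real (else `S` is CM: `hasComplexMultiplication_of_conj_ne`); `dim_ℚ T = 22 − ρ(S)`
(`finrank_ratPoints_eq`) so `[E:ℚ] = 2` and `r² = a r + b` (`exists_quadratic_relation_of_totallyReal`),
transported to `f` on `T(S) ⊗ ℂ = ι(ℂ ⊗ T)`; Zarhin's adjoint theorem: the adjoint `r'` of `r` has
`ε(r') = conj ε(r) = ε(r)`, so `r' = r`, i.e. `r` is self-adjoint for `−( . )|_T`, hence `φ_f` for `( . )`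
on `Λ_ℚ = N_ℚ ⊕ T` (`φ_f` kills `N_ℚ`, maps `T` to `T = N_ℚ^⊥`), hence `f` for the cup product.

No definition, no sorry, no named fact beyond the displayed `Huybrechts_K3_marking_exists`.
`--supports stmt-HodgeConjecture-19652`. Nothing here proves HC.

References: Yu. G. Zarhin, J. reine angew. Math. 341 (1983) Thm. 1.5.1, 1.6; B. van Geemen, Michigan Math.
J. 56 (2008) Lemma 3.2; D. Huybrechts, *Lectures on K3 Surfaces*, Ch. 3 Thm. 3.3.7, Lemma 3.3.12.
-/

set_option linter.dupNamespace false

noncomputable section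

namespace Summit.HodgeConjecture.HodgeConjecture.Theorems.MarkmanPartnerTransport.KugaSatakeSimilitude

open scoped Manifold TensorProduct
open Module CategoryTheory MonoidalCategory CartesianMonoidalCategory Polynomial
open Literature.AlgebraicGeometry Literature.AlgebraicGeometry.Motives Literature.AlgebraicGeometry.HodgeTheory
open Literature.AlgebraicGeometry.Motives.HodgeStructure
open Literature.AlgebraicGeometry.Surfaces
open Literature.AlgebraicTopology.SingularHomology
open Summit.HodgeConjecture.HodgeConjecture.Theorems
open Summit.HodgeConjecture.HodgeConjecture.Theorems.NikulinTwinTransport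
open Summit.HodgeConjecture.HodgeConjecture.Theorems.AnchorExistenceCMFloor
open Summit.HodgeConjecture.HodgeConjecture.Theorems.MarkmanPartnerTransport.RealMultiplicationRanks
open Summit.HodgeConjecture.HodgeConjecture.Theorems.MarkmanPartnerTransport.OneCycle

variable {S : SchemeOver ℂ}

/-- `Transc[S, y]`: `y` is cup-orthogonal to `N¹(S)`. Local notation only. -/
local notation3 (prettyPrint := false) "Transc[" S ", " y "]" =>
  (∀ d ∈ algebraicClasses S 1, cupProduct (rfl : 2 * 1 + 2 * 1 = 2 * 2) y d = 0)

/-- **The quadratic relation and self-adjointness of a non-scalar transcendental Hodge endomorphism,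
at the ranks forcing `[E(S):ℚ] = 2`.** For a projective K3 surface `S`, not CM, with `d · m + ρ(S) = 22`,
`d ≥ 2`, `m ≥ 3` forcing `d = 2`, and `f ∈ End H²(S(ℂ); ℂ)` rational, type-preserving, killing `N¹(S)`,
with image cup-orthogonal to `N¹(S)` and NOT a rational scalar on `T(S)`: there are `a, b ∈ ℚ` with `b ≠ 0`,
`a² + 4b ≠ 0`, `f² = a f + b` on `T(S)`, `f` cup-self-adjoint, and the `(2,0)`-eigenvalue `ev` of `f`
satisfies `ev² = a ev + b` and is irrational. Marking picture (module docstring). Granted markings.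
[cite: Zarhin1983HodgeGroupsK3, Thm. 1.5.1 and Thm. 1.6] [cite: Vangeemen2008, Lemma 3.2]
[cite: Huybrechts2016K3, Ch. 3 Thm. 3.3.7 and Lemma 3.3.12] -/
theorem exists_quadratic_relation_selfAdjoint (hmark : Huybrechts_K3_marking_exists) (hS : IsK3Surface S)
    (hρ : ∀ d m : ℕ, 2 ≤ d → 3 ≤ m → d * m + Module.finrank ℂ ↥(algebraicClasses S 1) = 22 → d = 2)
    (hCM : ¬ HasComplexMultiplication S) (f : complexBetti S (2 * 1) →ₗ[ℂ] complexBetti S (2 * 1))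
    (hf_rat : ∀ y, IsRationalClass y → IsRationalClass (f y))
    (hf_typ : ∀ (i j : ℕ) y, IsOfHodgeType 2 S (2 * 1) i j y → IsOfHodgeType 2 S (2 * 1) i j (f y))
    (hf_N : ∀ d ∈ algebraicClasses S 1, f d = 0) (hf_perp : ∀ y : complexBetti S (2 * 1), Transc[S, f y])
    (hfns : ∀ a : ℚ, ∃ y : complexBetti S (2 * 1), Transc[S, y] ∧ f y ≠ (a : ℂ) • y) :
    ∃ a b : ℚ, b ≠ 0 ∧ a * a + 4 * b ≠ 0 ∧
      (∀ y : complexBetti S (2 * 1), Transc[S, y] → f (f y) = (a : ℂ) • f y + (b : ℂ) • y) ∧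
      (∀ y w : complexBetti S (2 * 1),
        cupProduct (rfl : 2 * 1 + 2 * 1 = 2 * 2) (f y) w = cupProduct (rfl : 2 * 1 + 2 * 1 = 2 * 2) y (f w)) ∧
      (∀ (σ₀ : complexBetti S (2 * 1)) (ev : ℂ), IsOfHodgeType 2 S (2 * 1) 2 0 σ₀ → σ₀ ≠ 0 → f σ₀ = ev • σ₀ →
        ev * ev = (a : ℂ) * ev + (b : ℂ) ∧ ∀ q : ℚ, (q : ℂ) ≠ ev) := by
  classical
  have h4 : 2 * 1 + 2 * 1 = 2 * 2 := rfl
  -- ### the marking picture (as in `OneCycle.generatedBy_or_hasComplexMultiplication_of_eigenvalue`)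
  have hHT : Huybrechts_K3_hodgeTypes_H2 := Huybrechts_K3_hodgeTypes_H2_holds
  obtain ⟨η, p₀, x, hp₀, ⟨hp₀int, hp₀gen, hηint, hηcup, hx20, hx20'⟩, hxx, hxpos, hu⟩ := hmark S hS
  set N := algebraicClasses S 1 with hNdef
  set σ := η.symm x with hσdef
  have hησ : η σ = x := by rw [hσdef, LinearEquiv.apply_symm_apply]
  have hxne : σ ≠ 0 := by
    intro h0
    have hx : x = 0 := by rw [← hησ, h0, map_zero]
    subst hx
    simp [k3Form] at hxpos
  have hxne' : x ≠ 0 := fun h => hxne (by rw [hσdef, h, map_zero])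
  obtain ⟨h₁, -, h₃⟩ := hHT S hS σ hx20 hxne
  have hσbar : conjClass (ComplexPoints S) (2 * 1) σ = η.symm (star x) := conjClass_marking_symm η hηint x
  have hsmul0 : ∀ {c : ℂ}, c • p₀ = 0 → c = 0 := fun h => by
    rcases smul_eq_zero.1 h with h | h
    · exact h
    · exact absurd h hp₀
  have hL11 : ∀ c : complexBetti S (2 * 1), IsRationalClass c → IsOfHodgeType 2 S (2 * 1) 1 1 c → c ∈ N :=
    fun c hc h11 => lefschetzOneOne_rational_holds hS.1 c hc h11
  have hND : ∀ c ∈ N, IsRationalClass c →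
      (∀ d ∈ N, cupProduct (rfl : 2 * 1 + 2 * 1 = 2 * 2) c d = 0) → c = 0 :=
    fun c hcN hc hperp => anchorExistence_cmFloor_divisorClass_eq_zero_of_hodgeIndex
      hodgeIndex_surface_holds lefschetzOneOne_rational_holds
      Grothendieck1969_supportedClasses_le_hodgeConiveau_holds hS hcN hc hperp
  -- the eigenvalue of `f` on `σ`
  obtain ⟨ev, heσ⟩ : ∃ ev : ℂ, f σ = ev • σ := by
    obtain ⟨t, ht⟩ := hx20' (f σ) (hf_typ 2 0 σ hx20)
    exact ⟨t, ht⟩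
  -- rational classes are `Λ_ℚ`
  have hrat : ∀ c, IsRationalClass c ↔ ∃ w : K3Index → ℚ, η c = fun i => (w i : ℂ) :=
    isRationalClass_iff_of_marking hS η hηint
  -- the rational points of `N`
  let NQ : Submodule ℚ (K3Index → ℚ) :=
    { carrier := {u | η.symm (fun j => (u j : ℂ)) ∈ N}
      add_mem' := fun {u v} hu hv => by
        simp only [Set.mem_setOf_eq, ratCastΛ_add, map_add]
        exact N.add_mem hu hv
      zero_mem' := by
        simp only [Set.mem_setOf_eq, ratCastΛ_zero, map_zero]
        exact N.zero_mem
      smul_mem' := fun q u hu => by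
        simp only [Set.mem_setOf_eq, ratCastΛ_smul, map_smul]
        exact N.smul_mem _ hu }
  have memNQ : ∀ u, u ∈ NQ ↔ η.symm (fun j => (u j : ℂ)) ∈ N := fun u => Iff.rfl
  -- `(1,1)`-classes through the marking
  have h11_iff : ∀ v : K3Index → ℂ, IsOfHodgeType 2 S (2 * 1) 1 1 (η.symm v) ↔
      (k3Form v x = 0 ∧ k3Form v (star x) = 0) := by
    intro v
    rw [h₃ (η.symm v), hηcup, hηcup, LinearEquiv.apply_symm_apply, hησ, hσbar, LinearEquiv.apply_symm_apply]
    constructor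
    · rintro ⟨ha, hb⟩
      exact ⟨hsmul0 ha, hsmul0 hb⟩
    · rintro ⟨ha, hb⟩
      rw [ha, hb, zero_smul]
      exact ⟨rfl, rfl⟩
  -- `N_ℚ = Λ_ℚ ∩ {x, x̄}^⊥`
  have hN : ∀ u : K3Index → ℚ, u ∈ NQ ↔
      (k3Form (fun i => (u i : ℂ)) x = 0 ∧ k3Form (fun i => (u i : ℂ)) (star x) = 0) := by
    intro u
    rw [memNQ, ← h11_iff]
    constructor
    · intro hu
      exact isOfHodgeType_of_mem_algebraicClasses_of_isSmoothProjective hS.1 1 hu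
    · intro hu
      exact hL11 _ ((hrat _).2 ⟨u, LinearEquiv.apply_symm_apply _ _⟩) hu
  -- `N` is spanned by its rational classes, so `N_ℚ^⊥ ⊗ ℂ ⊥ N`
  have hspan := span_isRationalClass_eq_top_of_isSmoothProjective_holds.supportedClasses_eq_span
    hS.1 (2 * 1) 1
  have horth : ∀ u ∈ k3FormRat.orthogonal NQ, ∀ d ∈ N, k3Form (fun j => (u j : ℂ)) (η d) = 0 := by
    intro u hu d hd
    rw [LinearMap.BilinForm.mem_orthogonal_iff] at hu
    have hd' : d ∈ Submodule.span ℂ {c : complexBetti S (2 * 1) |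
        IsRationalClass c ∧ c ∈ supportedClasses S (2 * 1) 1} := by
      rw [← hspan]; exact hd
    clear hd
    induction hd' using Submodule.span_induction with
    | mem d hd =>
      obtain ⟨w, hw⟩ := (hrat d).1 hd.1
      have hwN : w ∈ NQ := by
        rw [memNQ, ← hw, LinearEquiv.symm_apply_apply]
        exact hd.2
      rw [hw, k3Form_ratCast, k3FormRat_isSymm.eq, hu w hwN, Rat.cast_zero]
    | zero => rw [map_zero, k3Form_zero_right]
    | add c c' _ _ hc hc' => rw [map_add, k3Form_add_right, hc, hc', add_zero]
    | smul t c _ hc => rw [map_smul, k3Form_smul_right, hc, mul_zero]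
  -- `N_ℚ ∩ N_ℚ^⊥ = 0` (Hodge index)
  have hdisj : Disjoint NQ (k3FormRat.orthogonal NQ) := by
    rw [Submodule.disjoint_def]
    intro u huN huT
    have hc0 : η.symm (fun j => (u j : ℂ)) = 0 :=
      hND _ ((memNQ u).1 huN) ((hrat _).2 ⟨u, LinearEquiv.apply_symm_apply _ _⟩) fun d hd => by
        rw [hηcup, LinearEquiv.apply_symm_apply, horth u huT d hd, zero_smul]
    apply ratCastΛ_injective
    rw [ratCastΛ_zero]
    exact η.symm.injective (hc0.trans (map_zero _).symm)
  have hc := isCompl_orthogonal hdisj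
  -- the transcendental Hodge structure, irreducible of K3 type, polarized; its endomorphism field
  set H := hodgeT hN hdisj hxx hxpos with hH
  have hK3 : H.IsOfK3Type := isOfK3Type_hodgeT hN hdisj hxx hxpos
  have hirr : H.IsIrreducible := isIrreducible_hodgeT hN hdisj hxx hxpos
  set ψ : H.Polarization := polT hN hdisj hxx hxpos hu with hψ
  obtain ⟨hFld, ε, hεinj, hε⟩ := Zarhin1983_endAlg_isField_holds H hirr hK3
  have hω : omega x hdisj ∈ H.piece 2 0 := (mem_piece_two_zero_ofPeriod _ _).2 ⟨1, one_smul _ _⟩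
  -- reading a rational type-preserving endomorphism of `H²(S)` in `E = End_Hdg(T)`
  have read : ∀ (G : complexBetti S (2 * 1) →ₗ[ℂ] complexBetti S (2 * 1)),
      (∀ y, IsRationalClass y → IsRationalClass (G y)) →
      (∀ (i j : ℕ) y, IsOfHodgeType 2 S (2 * 1) i j y → IsOfHodgeType 2 S (2 * 1) i j (G y)) →
      ∃ (φ : Module.End ℚ (K3Index → ℚ)) (hφT : ∀ t ∈ k3FormRat.orthogonal NQ,
          φ t ∈ k3FormRat.orthogonal NQ),
        cxEnd φ = η.toLinearMap ∘ₗ G ∘ₗ η.symm.toLinearMap ∧ φ.restrict hφT ∈ H.endAlg := by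
    intro G hG_rat hG_typ
    obtain ⟨φ, hφM, hφx, hφ11⟩ := anchorExistence_cmFloor_exists_ratEnd hHT hS η p₀ hp₀ hηint hηcup x hx20
      hx20' hxne G hG_rat hG_typ
    have hφT : ∀ t ∈ k3FormRat.orthogonal NQ, φ t ∈ k3FormRat.orthogonal NQ :=
      fun t ht => map_mem_T hN φ hφx ht
    exact ⟨φ, hφT, hφM, restrict_mem_endAlg hN hdisj hxx hxpos φ hφT hφx hφ11⟩
  obtain ⟨φf, hφfT, hφfM, hrf⟩ := read f hf_rat hf_typ
  have hφfMapp : ∀ v, cxEnd φf v = η (f (η.symm v)) := fun v => by rw [hφfM]; rfl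
  set r : H.endAlg := ⟨φf.restrict hφfT, hrf⟩ with hrdef
  have hrval : ((r : H.endAlg) : Module.End ℚ ↥(k3FormRat.orthogonal NQ)) = φf.restrict hφfT := rfl
  -- transcendental classes lie in `T_ℂ = ι(ℂ ⊗ T_ℚ)`
  have htr : ∀ y : complexBetti S (2 * 1), Transc[S, y] →
      iota _ (lam hc (η y)) = η y := by
    intro y hy
    have hzN : ∀ n ∈ NQ, k3Form (η y) (fun i => (n i : ℂ)) = 0 := by
      intro n hn
      have h := hy _ ((memNQ n).1 hn)
      rw [hηcup, LinearEquiv.apply_symm_apply] at h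
      exact hsmul0 h
    exact iota_lam_of_proj_eq_zero hc (cxEnd_projection_eq_zero hdisj hzN)
  -- `f` on `T` through `r`: `η (f y) = ι (r_ℂ z)` for `ι z = η y`
  have hfT : ∀ y : complexBetti S (2 * 1), Transc[S, y] →
      η (f y) = iota _ (((r : H.endAlg) : Module.End ℚ ↥(k3FormRat.orthogonal NQ)).baseChange ℂ
        (lam hc (η y))) := by
    intro y hy
    rw [hrval, iota_baseChange_restrict φf hφfT, htr y hy, hφfMapp, LinearEquiv.symm_apply_apply]
  -- `ε(r)` is the `(2,0)`-eigenvalue of `f`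
  have hεre : ε r = ev := by
    have h := hε r (omega x hdisj) hω
    have h2 := congrArg (iota (k3FormRat.orthogonal NQ)) h
    rw [hrval, iota_baseChange_restrict φf hφfT, iota_omega hN hdisj, map_smul, iota_omega hN hdisj,
      hφfMapp, ← hσdef, heσ, map_smul, hησ] at h2
    have h3 : (ev - ε r) • x = 0 := by rw [sub_smul, h2, sub_self]
    rcases smul_eq_zero.1 h3 with h5 | h5
    · exact (sub_eq_zero.1 h5).symm
    · exact absurd h5 hxne'
  -- `r` is not a rational scalar (else `f` would be scalar on `T`)
  have hre_bot : r ∉ (⊥ : Subalgebra ℚ H.endAlg) := by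
    intro h
    rw [Algebra.mem_bot] at h
    obtain ⟨a, ha⟩ := h
    obtain ⟨y, hy, hne⟩ := hfns a
    apply hne
    apply η.injective
    rw [hfT y hy, ← ha, Subalgebra.coe_algebraMap, Algebra.algebraMap_eq_smul_one, LinearMap.baseChange_smul,
      LinearMap.smul_apply, LinearMap.baseChange_one, Module.End.one_apply, ← algebraMap_smul ℂ a,
      map_smul, htr y hy, map_smul, eq_ratCast]
  have hev : ∀ q : ℚ, (q : ℂ) ≠ ev := by
    intro q hq
    apply hre_bot
    rw [Algebra.mem_bot]
    refine ⟨q, hεinj ?_⟩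
    rw [AlgHom.commutes, eq_ratCast, hεre, hq]
  -- `E` is totally real (else `S` is CM: `hasComplexMultiplication_of_conj_ne`)
  have hreal : ∀ (φ' : H.endAlg →+* ℂ) (a : H.endAlg), starRingEnd ℂ (φ' a) = φ' a := by
    by_contra hreal
    push Not at hreal
    obtain ⟨φ', a, hφ'a⟩ := hreal
    exact hCM (hasComplexMultiplication_of_conj_ne hS η p₀ hp₀ hηint hηcup x hx20 hxne hN hdisj hxx hxpos hu
      a φ' hφ'a)
  -- ### `[E : ℚ] = 2`: the quadratic relation `r² = a r + b`
  -- `dim_ℚ N_ℚ = dim_ℂ N` (`finrank_ratPoints_eq`), hence `dim_ℚ T + ρ(S) = 22`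
  have hdimT : Module.finrank ℚ ↥(k3FormRat.orthogonal NQ) + Module.finrank ℂ ↥N = 22 := by
    have hdimN : Module.finrank ℚ ↥NQ = Module.finrank ℂ ↥N := finrank_ratPoints_eq hS η hηint NQ memNQ
    have hdimΛ : Module.finrank ℚ (K3Index → ℚ) = 22 := by
      rw [Module.finrank_fintype_fun_eq_card]
      simp [Fintype.card_sum, Fintype.card_fin]
    have h := Submodule.finrank_add_eq_of_isCompl hc
    omega
  have hV : ∀ d m : ℕ, 2 ≤ d → 3 ≤ m → Module.finrank ℚ ↥(k3FormRat.orthogonal NQ) = d * m → d = 2 :=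
    fun d m hd hm h => hρ d m hd hm (by rw [← h]; exact hdimT)
  obtain ⟨a, b, hb, hd, hrel⟩ := exists_quadratic_relation_of_totallyReal hirr hK3 ψ hFld hreal hV hre_bot
  have hb' : (b : ℂ) ≠ 0 := by exact_mod_cast hb
  -- the relation on the eigenvalue: `ev² = a ev + b`
  have hevrel : ev * ev = (a : ℂ) * ev + (b : ℂ) := by
    have h := congrArg ε hrel
    rw [map_mul, map_add, map_smul, AlgHom.commutes, hεre, eq_ratCast, Algebra.smul_def, eq_ratCast] at h
    exact h
  -- the relation on `T`, through `r`
  have hrelT : (LinearMap.restrict φf hφfT) * (LinearMap.restrict φf hφfT) =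
      a • LinearMap.restrict φf hφfT + b • (1 : Module.End ℚ ↥(k3FormRat.orthogonal NQ)) := by
    have h := congrArg (fun e : H.endAlg => (e : Module.End ℚ ↥(k3FormRat.orthogonal NQ))) hrel
    simp only [Subalgebra.coe_mul, Subalgebra.coe_add, Subalgebra.coe_smul, Algebra.algebraMap_eq_smul_one] at h
    exact h
  have hbc : ∀ z : ℂ ⊗[ℚ] ↥(k3FormRat.orthogonal NQ),
      (LinearMap.restrict φf hφfT).baseChange ℂ ((LinearMap.restrict φf hφfT).baseChange ℂ z) =
        a • (LinearMap.restrict φf hφfT).baseChange ℂ z + b • z := by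
    intro z
    have h := LinearMap.congr_fun (congrArg (LinearMap.baseChange ℂ) hrelT) z
    rw [LinearMap.baseChange_mul, Module.End.mul_apply, LinearMap.baseChange_add, LinearMap.baseChange_smul,
      LinearMap.baseChange_smul, LinearMap.baseChange_one, LinearMap.add_apply, LinearMap.smul_apply,
      LinearMap.smul_apply, Module.End.one_apply] at h
    exact h
  -- ### `f² = a f + b` on `T(S)`
  have hffT : ∀ y : complexBetti S (2 * 1), Transc[S, y] → f (f y) = (a : ℂ) • f y + (b : ℂ) • y := by
    intro y hy
    apply η.injective
    have h1 := hfT y hy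
    have h2 := hfT (f y) (hf_perp y)
    rw [h1, lam_iota, hrval, hbc, map_add, ← algebraMap_smul ℂ a, ← algebraMap_smul ℂ b, map_smul, map_smul,
      eq_ratCast, eq_ratCast, ← hrval, ← h1, htr y hy] at h2
    rw [h2, map_add, map_smul, map_smul]
  -- ### Zarhin: `f` is cup-self-adjoint
  obtain ⟨hadjex, hadjconj⟩ := Zarhin1983_adjoint_eq_conj_holds H hirr hK3 ψ
  obtain ⟨r', hr'⟩ := hadjex r
  have hrr' : r' = r := hεinj (by
    have key := hadjconj r r' hr' ε.toRingHom
    change ε r' = starRingEnd ℂ (ε r) at key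
    rw [key]
    exact hreal ε.toRingHom r)
  rw [hrr'] at hr'
  have hsaT : ∀ t t' : ↥(k3FormRat.orthogonal NQ), k3FormRat (φf t) t' = k3FormRat t (φf t') := by
    intro t t'
    have h := hr' t t'
    change (-(k3FormRat.restrict (k3FormRat.orthogonal NQ))) ((LinearMap.restrict φf hφfT) t) t' =
      (-(k3FormRat.restrict (k3FormRat.orthogonal NQ))) t ((LinearMap.restrict φf hφfT) t') at h
    rw [LinearMap.neg_apply, LinearMap.neg_apply, LinearMap.neg_apply, LinearMap.neg_apply, neg_inj,
      LinearMap.BilinForm.restrict_apply, LinearMap.BilinForm.restrict_apply, LinearMap.domRestrict_apply,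
      LinearMap.domRestrict_apply, LinearMap.coe_restrict_apply, LinearMap.coe_restrict_apply] at h
    exact h
  have hφfN0 : ∀ n ∈ NQ, φf n = 0 := by
    intro n hn
    apply ratCastΛ_injective
    rw [ratCastΛ_zero, ← cxEnd_ratCast, hφfMapp, hf_N _ ((memNQ n).1 hn), map_zero]
  have hot : ∀ n ∈ NQ, ∀ t ∈ k3FormRat.orthogonal NQ, k3FormRat n t = 0 := by
    intro n hn t ht
    rw [LinearMap.BilinForm.mem_orthogonal_iff] at ht
    exact ht n hn
  have hsaQ : ∀ u v : K3Index → ℚ, k3FormRat (φf u) v = k3FormRat u (φf v) := by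
    intro u v
    have hu : u ∈ NQ ⊔ k3FormRat.orthogonal NQ := by rw [hc.sup_eq_top]; exact Submodule.mem_top
    have hv : v ∈ NQ ⊔ k3FormRat.orthogonal NQ := by rw [hc.sup_eq_top]; exact Submodule.mem_top
    obtain ⟨n, hn, t, ht, rfl⟩ := Submodule.mem_sup.1 hu
    obtain ⟨n', hn', t', ht', rfl⟩ := Submodule.mem_sup.1 hv
    have hl : φf (n + t) = φf t := by rw [map_add, hφfN0 n hn, zero_add]
    have hr2 : φf (n' + t') = φf t' := by rw [map_add, hφfN0 n' hn', zero_add]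
    have e₁ : k3FormRat (φf t) (n' + t') = k3FormRat (φf t) t' := by
      rw [map_add, k3FormRat_isSymm.eq (φf t) n', hot n' hn' _ (hφfT t ht), zero_add]
    have e₂ : k3FormRat (n + t) (φf t') = k3FormRat t (φf t') := by
      rw [map_add, LinearMap.add_apply, hot n hn _ (hφfT t' ht'), zero_add]
    rw [hl, hr2, e₁, e₂]
    exact hsaT ⟨t, ht⟩ ⟨t', ht'⟩
  have hsaC : ∀ α β : K3Index → ℂ, k3Form (cxEnd φf α) β = k3Form α (cxEnd φf β) := by
    have hC : k3FormC.compl₁₂ (cxEnd φf) LinearMap.id = k3FormC.compl₁₂ LinearMap.id (cxEnd φf) := by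
      refine eq_of_forall_ratCast fun v => eq_of_forall_ratCast fun w => ?_
      rw [LinearMap.compl₁₂_apply, LinearMap.compl₁₂_apply, LinearMap.id_apply, LinearMap.id_apply,
        cxEnd_ratCast, cxEnd_ratCast, k3FormC_apply, k3FormC_apply, k3Form_ratCast, k3Form_ratCast, hsaQ]
    intro α β
    have h := LinearMap.congr_fun₂ hC α β
    simpa only [LinearMap.compl₁₂_apply, LinearMap.id_apply, k3FormC_apply] using h
  have hηf : ∀ y, η (f y) = cxEnd φf (η y) := fun y => by rw [hφfMapp, LinearEquiv.symm_apply_apply]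
  have hsa : ∀ y w : complexBetti S (2 * 1),
      cupProduct h4 (f y) w = cupProduct h4 y (f w) := by
    intro y w
    rw [hηcup, hηcup, hηf, hηf, hsaC]
  -- ### export: the `(2,0)`-eigenvalue of `f` on any non-zero `(2,0)`-class is `ev`
  refine ⟨a, b, hb, hd, hffT, hsa, fun σ₀ ev' h20 hne0 hev' => ?_⟩
  obtain ⟨t, ht⟩ := hx20' σ₀ h20
  have ht0 : t ≠ 0 := by
    rintro rfl
    rw [zero_smul] at ht
    exact hne0 ht
  have hevev : ev' = ev := by
    have h := hev'
    rw [ht, LinearMap.map_smul, heσ, smul_smul, smul_smul] at h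
    have h' := smul_left_injective ℂ hxne h
    -- h' : t * ev = ev' * t
    have h'' : (ev' - ev) * t = 0 := by rw [sub_mul, ← h', mul_comm]; ring
    rcases mul_eq_zero.1 h'' with h0 | h0
    · exact (sub_eq_zero.1 h0)
    · exact absurd h0 ht0
  subst hevev
  exact ⟨hevrel, hev⟩


end Summit.HodgeConjecture.HodgeConjecture.Theorems.MarkmanPartnerTransport.KugaSatakeSimilitude

end
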